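import Literature.Probability.Percolation.QuadCrossingSpaceZ2
import Literature.Probability.Percolation.QuadCrossingLowerSets
import HarnessLib

/-!
# DKKMO's Theorem 1.2, Schramm–Smirnov half, at `q = 1` in the plane (named fact)

Topic `Probability/Percolation`; companion of `QuadCrossingRotationInvariance.lean` (the per-quad
Corollary 1.3, `dkkmo_crossing_rotation_invariance`), `QuadCrossingRotationInvarianceOfSS.lean`
(Cor. 1.3 from the `d_SS` half of Theorem 1.2 + continuity, with that half as the explicit
hypothesis `hSS`) and `LoopRepresentation.lean` (`dkkmo_theorem_1_2`, the `d_CN` half).  This file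
vendors the `d_SS` half itself, which those files leave as a hypothesis:

* `dkkmo_theorem_1_2_schrammSmirnov` — the ONE NAMED FACT of this file: Duminil-Copin–Kozlowski–
  Krachun–Manolescu–Oulamara, arXiv:2012.11672v1, Theorem 1.2 (`d_SS` part) at `q = 1` and
  `Ω = ℝ²` (§1.3: "By taking the limit as `Ω` tends to `ℝ²` of the results below, we also obtain
  the statement for the unique infinite-volume measure"; proof §7.1 "Case of `Ω = ℝ²`", p. 42):
  for `ε > 0` there is `δ₀ > 0` such that for all `α ∈ (ε, π - ε)` and `0 < δ ≤ δ₀` some coupling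
  `ℙ` of `ω_δ, ω'_δ ∼ P_{1/2}` on `δℤ²` makes `S_{ω_δ}` and `e^{iα}·S_{ω'_δ}` close in `ℋ_ℂ` with
  probability `> 1 - ε`.  "Close" is rendered METRIC-FREE ("`d_SS`, the metric whose definition is
  implicit", §1.2 p. 4): outside an event of probability `< ε` the pair lies in a prescribed open
  neighbourhood `N` of the diagonal of `ℋ_ℂ × ℋ_ℂ` (`δ₀ = δ₀(ε, N)`).  VERBATIM the hypothesis
  `hSS` of `dkkmo_crossing_rotation_invariance_of_schrammSmirnov`.
* `dkkmo_theorem_1_2_schrammSmirnov_of_dist` (PROVED) — the printed form, for ANY jointly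
  continuous `d` on `ℋ_ℂ` positive off the diagonal (in particular any metric inducing the
  topology `𝒯`), implies the metric-free one (`ℋ_ℂ` is compact, `QuadConfig.compactSpace`: `d` is
  bounded below on the complement of `N`); `dist_lt_of_dkkmo_theorem_1_2_schrammSmirnov` (PROVED) —
  conversely the metric-free form gives the printed bound `ℙ[d > ε] < ε` for every such `d` with
  `d S S = 0` (`{d < ε}` is an open neighbourhood of the diagonal).  So the rendering is equivalent
  to the printed statement for every metric compatible with `𝒯` (`ℋ_ℂ` is metrizable,
  Schramm–Smirnov Thm. 1.4, `SchrammSmirnov2011_thm_1_4_holds`).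

Consumer: `Summits/CriticalPhenomena/CardyFormulaZ2/Theorems/CardySelfRefinementRotationInput.lean`
(rotation invariance of every subsequential quad-crossing limit, `RotationInput`, from this fact
by a coupling transfer of weak limits).

## References

* [DKKMO2020Rotational] H. Duminil-Copin, K. K. Kozlowski, D. Krachun, I. Manolescu, M. Oulamara,
  *Rotational invariance in critical planar lattice models*, arXiv:2012.11672v1 (2020): §1.2 p. 4
  (`𝔥`, `d_SS`), Thm. 1.2 p. 5, §1.3 (infinite volume), §7.1 p. 42 (proof, case `Ω = ℝ²`); v2
  (2026) states Thm. 1.2 quantitatively (`≤ C δ^c`, all angles) [arXiv201211672v2].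
* [SchrammSmirnov2011] O. Schramm, S. Smirnov, Ann. Probab. 39 (2011), §1.3, Thm. 1.4.
* [Tassion2024] V. Tassion, Sém. Bourbaki Exp. 1210 (the case `q = 1`).
-/

noncomputable section

open Set Filter
open _root_.MeasureTheory _root_.Topology
open scoped ENNReal
open Literature.Probability.LatticeModels

namespace Literature.Probability.Percolation

open QuadCrossing

/-- **DKKMO, Theorem 1.2 (`d_SS` part) at `q = 1` in the plane** (Duminil-Copin–Kozlowski–Krachun–
Manolescu–Oulamara, arXiv:2012.11672v1, Thm. 1.2 p. 5: "Fix `q ∈ [1,4]` and a simply connected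
domain `Ω` with a `C¹`-smooth boundary. For every `ε > 0`, there exists `δ₀ = δ₀(q, ε, Ω) > 0` such
that for every `α ∈ (ε, π - ε)` and `δ ≤ δ₀`, there exists a coupling `ℙ` between
`ω_δ ∼ φ⁰_{Ω_δ}` and `ω'_δ ∼ φ⁰_{(e^{-iα}Ω)_δ}` such that `ℙ[d_SS(ω_δ, e^{iα}ω'_δ) > ε] < ε`";
§1.3: "By taking the limit as `Ω` tends to `ℝ²` of the results below, we also obtain the statement
for the unique infinite-volume measure"; proof §7.1, "Case of `Ω = ℝ²`", p. 42).  Here `q = 1`,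
`Ω = ℝ²`: `φ` is critical bond percolation `P_{1/2} = bondPercolation (zdGraph 2) half` on `ℤ²`,
`ω_δ` is read in the Schramm–Smirnov space `ℋ_ℂ = QuadCrossingSpace univ` as
`S_{ω_δ} = z2QuadConfig univ δ ω`, and `e^{iα} ω'_δ` (the sample drawn on the rotated lattice
`e^{iα} δℤ²`) as `QuadConfig.rotate α (z2QuadConfig univ δ ω')`.  The event `d_SS > ε` ("`d_SS`,
the metric whose definition is implicit", §1.2 p. 4) is rendered METRIC-FREE: for every open
neighbourhood `N` of the diagonal of `ℋ_ℂ × ℋ_ℂ`, `ℙ[(S_{ω_δ}, e^{iα}·S_{ω'_δ}) ∉ N] < ε` for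
`0 < δ ≤ δ₀(ε, N)` — equivalent to the printed form for any metric inducing the topology `𝒯`
(`dkkmo_theorem_1_2_schrammSmirnov_of_dist`, `dist_lt_of_dkkmo_theorem_1_2_schrammSmirnov`;
`ℋ_ℂ` is compact metrizable, Schramm–Smirnov Thm. 1.4).  Verbatim the hypothesis `hSS` of
`dkkmo_crossing_rotation_invariance_of_schrammSmirnov`; the `d_CN` half is `dkkmo_theorem_1_2`
(`LoopRepresentation.lean`).  Named fact (D-0014), not proved here.
-- TODO(general form): `q ∈ [1,4]` random-cluster measures and `C¹` domains `Ω` (free b.c.).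
[cite: DKKMO2020Rotational, Thm 1.2 (q = 1, Ω = ℝ²), §1.3, §7.1 p. 42] -/
def dkkmo_theorem_1_2_schrammSmirnov : Prop :=
  ∀ ε : ℝ, 0 < ε →
    ∀ N : Set (QuadCrossingSpace (univ : Set ℂ) × QuadCrossingSpace (univ : Set ℂ)), IsOpen N →
      (∀ S, (S, S) ∈ N) →
      ∃ δ₀ : ℝ, 0 < δ₀ ∧ ∀ α ∈ Set.Ioo ε (Real.pi - ε), ∀ δ : ℝ, 0 < δ → δ ≤ δ₀ →
        ∃ P : Measure (BondConfig (Site 2) × BondConfig (Site 2)),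
          P.map Prod.fst = bondPercolation (zdGraph 2) half ∧
          P.map Prod.snd = bondPercolation (zdGraph 2) half ∧
          P {p | (z2QuadConfig univ δ p.1, QuadConfig.rotate α (z2QuadConfig univ δ p.2)) ∉ N} <
            ENNReal.ofReal ε

/-- **The printed (metric) form implies the metric-free one.**  For any jointly continuous
distance-like function `d` on `ℋ_ℂ`, positive off the diagonal — in particular any metric `d_SS`
inducing the topology `𝒯` — the printed statement "for every `ε > 0` there is `δ₀ > 0` such that
for `α ∈ (ε, π - ε)`, `0 < δ ≤ δ₀` some coupling has `ℙ[d_SS(ω_δ, e^{iα}ω'_δ) > ε] < ε`" implies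
`dkkmo_theorem_1_2_schrammSmirnov`: `ℋ_ℂ × ℋ_ℂ` is compact (`QuadConfig.compactSpace`), so `d` has
a positive minimum on the complement of an open neighbourhood `N` of the diagonal, and the printed
statement at a smaller `ε` only widens the angle range.
[cite: DKKMO2020Rotational, Thm 1.2 (d_SS part)] -/
theorem dkkmo_theorem_1_2_schrammSmirnov_of_dist
    (d : QuadCrossingSpace (univ : Set ℂ) → QuadCrossingSpace (univ : Set ℂ) → ℝ)
    (hdc : Continuous fun p : QuadCrossingSpace (univ : Set ℂ) × QuadCrossingSpace (univ : Set ℂ) =>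
      d p.1 p.2)
    (hdpos : ∀ S S', S ≠ S' → 0 < d S S')
    (hSSd : ∀ ε : ℝ, 0 < ε → ∃ δ₀ : ℝ, 0 < δ₀ ∧ ∀ α ∈ Set.Ioo ε (Real.pi - ε), ∀ δ : ℝ, 0 < δ →
      δ ≤ δ₀ → ∃ P : Measure (BondConfig (Site 2) × BondConfig (Site 2)),
        P.map Prod.fst = bondPercolation (zdGraph 2) half ∧
        P.map Prod.snd = bondPercolation (zdGraph 2) half ∧
        P {p | ε < d (z2QuadConfig univ δ p.1) (QuadConfig.rotate α (z2QuadConfig univ δ p.2))} <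
          ENNReal.ofReal ε) :
    dkkmo_theorem_1_2_schrammSmirnov := by
  intro ε hε N hN hdiag
  haveI : CompactSpace (QuadCrossingSpace (univ : Set ℂ)) := QuadConfig.compactSpace
  -- a positive `ε₁` with `{d < ε₁} ⊆ N`
  obtain ⟨ε₁, hε₁, hsub⟩ : ∃ ε₁ : ℝ, 0 < ε₁ ∧ ∀ p : QuadCrossingSpace (univ : Set ℂ) ×
      QuadCrossingSpace (univ : Set ℂ), d p.1 p.2 < ε₁ → p ∈ N := by
    by_cases hF : (Nᶜ : Set _).Nonempty
    · obtain ⟨p₀, hp₀, hmin⟩ := hN.isClosed_compl.isCompact.exists_isMinOn hF hdc.continuousOn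
      have hp₀pos : 0 < d p₀.1 p₀.2 := by
        refine hdpos _ _ fun heq => hp₀ ?_
        have : p₀ = (p₀.1, p₀.1) := Prod.ext rfl heq.symm
        rw [this]; exact hdiag _
      refine ⟨d p₀.1 p₀.2, hp₀pos, fun p hp => ?_⟩
      by_contra hpN
      exact (not_le.2 hp) (hmin hpN)
    · exact ⟨1, one_pos, fun p _ => by by_contra hpN; exact hF ⟨p, hpN⟩⟩
  have hε' : 0 < min ε (ε₁ / 2) := lt_min hε (by linarith)
  obtain ⟨δ₀, hδ₀, H⟩ := hSSd (min ε (ε₁ / 2)) hε'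
  refine ⟨δ₀, hδ₀, fun α hα δ hδ hδ₀' => ?_⟩
  have hα' : α ∈ Set.Ioo (min ε (ε₁ / 2)) (Real.pi - min ε (ε₁ / 2)) :=
    ⟨(min_le_left _ _).trans_lt hα.1, hα.2.trans_le (by linarith [min_le_left ε (ε₁ / 2)])⟩
  obtain ⟨P, h1, h2, hP⟩ := H α hα' δ hδ hδ₀'
  refine ⟨P, h1, h2, ((measure_mono fun p hp => ?_).trans_lt hP).trans_le
    (ENNReal.ofReal_le_ofReal (min_le_left _ _))⟩
  show min ε (ε₁ / 2) < d _ _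
  by_contra hle
  exact hp (hsub _ ((not_lt.1 hle).trans_lt (by linarith [min_le_right ε (ε₁ / 2)])))

/-- **The metric-free form gives back the printed bound** for every jointly continuous `d` on
`ℋ_ℂ` vanishing on the diagonal (in particular every metric inducing `𝒯`): `{d < ε}` is an open
neighbourhood of the diagonal, so `ℙ[d(S_{ω_δ}, e^{iα}·S_{ω'_δ}) > ε] ≤ ℙ[∉ {d < ε}] < ε` for
`α ∈ (ε, π - ε)`, `0 < δ ≤ δ₀(ε)`. [cite: DKKMO2020Rotational, Thm 1.2 (d_SS part)] -/
theorem dist_lt_of_dkkmo_theorem_1_2_schrammSmirnov (h : dkkmo_theorem_1_2_schrammSmirnov)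
    (d : QuadCrossingSpace (univ : Set ℂ) → QuadCrossingSpace (univ : Set ℂ) → ℝ)
    (hdc : Continuous fun p : QuadCrossingSpace (univ : Set ℂ) × QuadCrossingSpace (univ : Set ℂ) =>
      d p.1 p.2)
    (hd0 : ∀ S, d S S = 0) {ε : ℝ} (hε : 0 < ε) :
    ∃ δ₀ : ℝ, 0 < δ₀ ∧ ∀ α ∈ Set.Ioo ε (Real.pi - ε), ∀ δ : ℝ, 0 < δ → δ ≤ δ₀ →
      ∃ P : Measure (BondConfig (Site 2) × BondConfig (Site 2)),
        P.map Prod.fst = bondPercolation (zdGraph 2) half ∧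
        P.map Prod.snd = bondPercolation (zdGraph 2) half ∧
        P {p | ε < d (z2QuadConfig univ δ p.1) (QuadConfig.rotate α (z2QuadConfig univ δ p.2))} <
          ENNReal.ofReal ε := by
  set N : Set (QuadCrossingSpace (univ : Set ℂ) × QuadCrossingSpace (univ : Set ℂ)) :=
    {p | d p.1 p.2 < ε} with hN
  have hNopen : IsOpen N := isOpen_lt hdc continuous_const
  have hdiag : ∀ S, (S, S) ∈ N := fun S => by show d S S < ε; rw [hd0]; exact hε
  obtain ⟨δ₀, hδ₀, H⟩ := h ε hε N hNopen hdiag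
  refine ⟨δ₀, hδ₀, fun α hα δ hδ hδ₀' => ?_⟩
  obtain ⟨P, h1, h2, hP⟩ := H α hα δ hδ hδ₀'
  refine ⟨P, h1, h2, (measure_mono fun p hp => ?_).trans_lt hP⟩
  show ¬ d _ _ < ε
  exact not_lt.2 (le_of_lt hp)

end Literature.Probability.Percolation

end
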